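import Summits.RiemannHypothesis.RiemannHypothesis.Theorems.PfPersistenceGalerkinTestDensity
import Summits.RiemannHypothesis.RiemannHypothesis.Theorems.PfPersistenceGalerkinFormTests
import Summits.RiemannHypothesis.RiemannHypothesis.Theorems.PfPersistenceGalerkinFormRadiusArch
import HarnessLib

/-!
# GAL, Markov identity at the cut-off — the closed-form continuity engine

Support file for barrier-prover's second GAL route (`MarkovAtCutoff`,
`Theorems/PfPersistenceTallyTwin.lean`): the Markov closed form
`markovClosedForm a G = P(G) + 𝓔_a(G) − M_a‖G‖²` is continuous along a sequence of window
functions `G_k → G` in `L²` provided the jump forms are UNIFORMLY LINEAR, `D_t(G_k) ≤ C t`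
(`t > 0`).  This is the variant of cand-3's `TestDensity.tendsto_markovClosedForm` needed when
the limit `G` is the (discontinuous) cut-off profile: no sup-norm closeness and no smooth limit
are assumed; the domination of the archimedean energy integrand is `C ρ(t) t`.

Also recorded here (tools for the two approximating families of the route):
* `D_t(h) ≤ 2M ∫ |h(x+t) − h(x)| dx` for `|h| ≤ M` (jump form vs `L¹` modulus);
* the mollification `G ⋆ φ_k` of a bounded integrable `G` is bounded by the same constant,
  converges to `G(x)` at every continuity point `x` of `G`, and converges to `G` in `L²` when
  `G` vanishes off a window and is continuous almost everywhere;
* the cut-off `𝟙_{[-b,b]} f` of a continuous `f` is in `L²` and is continuous off `{±b}`.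

RH-free, data-free, no named facts.  Mechanism search only; no RH claims.
-/

set_option linter.dupNamespace false

noncomputable section

open Complex Filter Set MeasureTheory Topology
open scoped Real Convolution ComplexConjugate ContDiff

namespace Summit.RiemannHypothesis.RiemannHypothesis.Theorems.PfPersistence

open Literature.NumberTheory.LFunctions Literature.NumberTheory.LFunctions.WeilContinuous
open Literature.NumberTheory.LFunctions.ConnesVanSuijlekom
open Summit.RiemannHypothesis.RiemannHypothesis.Theorems.WeilGroundStateMarkovPart
  (tendsto_weilIncrement_of_tendsto)
open Summit.RiemannHypothesis.RiemannHypothesis.Theorems.OddSector (tendsto_weilPoleForm_of_window)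
open Summit.RiemannHypothesis.RiemannHypothesis.Theorems.PolarPerronFrobenius
  (continuous_weilIncrement_of_memLp_window)
open Summit.RiemannHypothesis.RiemannHypothesis.Theorems.GroundStatesConvergeToXi
  (dirichletMul_integrableOn_weilArchDensity_mul_self)

namespace ClosedFormEngine

variable {G : ℝ → ℂ} {Gk : ℕ → ℝ → ℂ} {f h : ℝ → ℂ}

/-! ## §1 The engine -/

/-- **Closed-form continuity engine.**  If `G_k → G` in `L²`, all functions are in `L²` and
vanish off `[-a, a]`, and the jump forms of the `G_k` are uniformly linear (`D_t(G_k) ≤ C t` for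
`t > 0`), then mass and the Markov closed form converge: `‖G_k‖² → ‖G‖²` and
`markovClosedForm a G_k → markovClosedForm a G`. [folklore] -/
theorem tendsto_markovClosedForm_of_increment_le {a C : ℝ} (hGm : MemLp G 2)
    (hGkm : ∀ k, MemLp (Gk k) 2) (hGz : ∀ x, x ∉ Icc (-a) a → G x = 0)
    (hGkz : ∀ k x, x ∉ Icc (-a) a → Gk k x = 0)
    (hL2 : Tendsto (fun k ↦ ∫ x, ‖Gk k x - G x‖ ^ 2) atTop (𝓝 0))
    (hinc : ∀ k t, 0 < t → weilIncrement (Gk k) t ≤ C * t) :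
    Tendsto (fun k ↦ ∫ x, ‖Gk k x‖ ^ 2) atTop (𝓝 (∫ x, ‖G x‖ ^ 2)) ∧
      Tendsto (fun k ↦ markovClosedForm a (Gk k)) atTop (𝓝 (markovClosedForm a G)) := by
  have hmass : Tendsto (fun k ↦ ∫ x, ‖Gk k x‖ ^ 2) atTop (𝓝 (∫ x, ‖G x‖ ^ 2)) :=
    tendsto_integral_norm_sq hGm hGkm hL2
  have hpole : Tendsto (fun k ↦ weilPoleForm (Gk k)) atTop (𝓝 (weilPoleForm G)) :=
    tendsto_weilPoleForm_of_window hGm hGkm hGz hGkz hL2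
  have hincT : ∀ t, Tendsto (fun k ↦ weilIncrement (Gk k) t) atTop (𝓝 (weilIncrement G t)) :=
    tendsto_weilIncrement_of_tendsto hGm hGkm hL2
  -- the archimedean energy converges (dominated convergence, majorant `C ρ(t) t`)
  have harch : Tendsto (fun k ↦ ∫ t in Ioi (0 : ℝ), weilArchDensity t * weilIncrement (Gk k) t)
      atTop (𝓝 (∫ t in Ioi (0 : ℝ), weilArchDensity t * weilIncrement G t)) := by
    refine tendsto_integral_of_dominated_convergence (fun t ↦ C * (weilArchDensity t * t))
      (fun k ↦ (measurable_weilArchDensity.mul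
        (continuous_weilIncrement_of_memLp_window (hGkm k) (hGkz k)).measurable).aestronglyMeasurable)
      (dirichletMul_integrableOn_weilArchDensity_mul_self.const_mul C)
      (fun k ↦ (ae_restrict_iff' measurableSet_Ioi).2 (Eventually.of_forall fun t ht ↦ ?_))
      (Eventually.of_forall fun t ↦ (hincT t).const_mul _)
    have hρ : 0 < weilArchDensity t := weilArchDensity_pos ht
    rw [Real.norm_of_nonneg (mul_nonneg hρ.le (weilIncrement_nonneg _ _))]
    calc weilArchDensity t * weilIncrement (Gk k) t ≤ weilArchDensity t * (C * t) :=
          mul_le_mul_of_nonneg_left (hinc k t ht) hρ.le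
      _ = C * (weilArchDensity t * t) := by ring
  have hD : Tendsto (fun k ↦ weilDirichletEnergy a (Gk k)) atTop
      (𝓝 (weilDirichletEnergy a G)) := by
    unfold weilDirichletEnergy
    exact (tendsto_finsetSum _ fun n _ ↦ (hincT _).const_mul _).add harch
  refine ⟨hmass, ?_⟩
  unfold markovClosedForm
  exact (hpole.add hD).sub (hmass.const_mul _)

/-! ## §2 Jump forms versus the `L¹` modulus of continuity -/

/-- `D_t(h) ≤ 2M · ∫ |h(x+t) − h(x)| dx` whenever `|h| ≤ M` and `h` is integrable. [folklore] -/
theorem weilIncrement_le_mul_integral_norm_sub {M : ℝ} (hM : ∀ x, ‖h x‖ ≤ M) (hhi : Integrable h)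
    (t : ℝ) : weilIncrement h t ≤ 2 * M * ∫ x, ‖h (x + t) - h x‖ := by
  have hint : Integrable fun x ↦ ‖h (x + t) - h x‖ := ((hhi.comp_add_right t).sub hhi).norm
  unfold weilIncrement
  rw [← integral_const_mul]
  refine integral_mono_of_nonneg (Eventually.of_forall fun x ↦ by positivity) (hint.const_mul _)
    (Eventually.of_forall fun x ↦ ?_)
  have h2 : ‖h (x + t) - h x‖ ≤ 2 * M := (norm_sub_le _ _).trans (by linarith [hM (x + t), hM x])
  calc ‖h (x + t) - h x‖ ^ 2 = ‖h (x + t) - h x‖ * ‖h (x + t) - h x‖ := sq _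
    _ ≤ 2 * M * ‖h (x + t) - h x‖ := mul_le_mul_of_nonneg_right h2 (norm_nonneg _)

/-! ## §3 Mollification of a bounded integrable function -/

/-- `u ↦ G(u) φ_k(x − u)` is integrable for `G` integrable. [folklore] -/
theorem integrable_mul_moll_sub (hGi : Integrable G) (k : ℕ) (x : ℝ) :
    Integrable fun u ↦ G u * moll k (x - u) := by
  obtain ⟨Cφ, hCφ⟩ := exists_norm_moll_le k
  have hm : AEStronglyMeasurable (fun u : ℝ ↦ moll k (x - u)) volume :=
    ((continuous_moll k).comp (continuous_const.sub continuous_id)).aestronglyMeasurable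
  exact (hGi.bdd_mul (c := Cφ) hm (Eventually.of_forall fun u ↦ hCφ _)).congr
    (Eventually.of_forall fun u ↦ mul_comm _ _)

/-- **Sup bound is preserved:** `|(G ⋆ φ_k)(x)| ≤ M` when `|G| ≤ M`. [folklore] -/
theorem norm_weilConv_moll_le {M : ℝ} (hM : ∀ x, ‖G x‖ ≤ M) (k : ℕ) (x : ℝ) :
    ‖weilConv G (moll k) x‖ ≤ M := by
  rw [weilConv_apply]
  have hint : Integrable fun u : ℝ ↦ M * ‖moll k (x - u)‖ :=
    ((integrable_norm_moll k).comp_sub_left x).const_mul M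
  calc ‖∫ u, G u * moll k (x - u)‖ ≤ ∫ u, ‖G u * moll k (x - u)‖ := norm_integral_le_integral_norm _
    _ ≤ ∫ u, M * ‖moll k (x - u)‖ := by
        refine integral_mono_of_nonneg (Eventually.of_forall fun u ↦ norm_nonneg _) hint
          (Eventually.of_forall fun u ↦ ?_)
        dsimp only
        rw [norm_mul]
        exact mul_le_mul_of_nonneg_right (hM u) (norm_nonneg _)
    _ = M := by
        rw [integral_const_mul, integral_sub_left_eq_self (fun u ↦ ‖moll k u‖) volume x,
          integral_norm_moll, mul_one]

/-- **Mollification converges at continuity points:** `(G ⋆ φ_k)(x) → G(x)` when `G` is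
integrable and continuous at `x` (the tree's `tendsto_weilConv_moll`, localised). [folklore] -/
theorem tendsto_weilConv_moll_of_continuousAt (hGi : Integrable G) {x : ℝ} (hx : ContinuousAt G x) :
    Tendsto (fun k ↦ weilConv G (moll k) x) atTop (𝓝 (G x)) := by
  rw [Metric.tendsto_nhds]
  intro ε hε
  obtain ⟨δ, hδ, hδg⟩ := Metric.continuousAt_iff.1 hx (ε / 2) (by positivity)
  have hk : ∀ᶠ k : ℕ in atTop, (bump k).rOut < δ := (tendsto_order.1 tendsto_bump_rOut).2 δ hδ
  filter_upwards [hk] with k hk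
  have hone : ∫ u : ℝ, moll k (x - u) = 1 := by
    rw [integral_sub_left_eq_self (fun u ↦ moll k u) volume x, integral_moll]
  have hgx : G x = ∫ u : ℝ, G x * moll k (x - u) := by
    rw [MeasureTheory.integral_const_mul, hone, mul_one]
  have hint1 : Integrable fun u : ℝ ↦ G u * moll k (x - u) := integrable_mul_moll_sub hGi k x
  have hint2 : Integrable fun u : ℝ ↦ G x * moll k (x - u) :=
    (((continuous_moll k).comp (continuous_const.sub continuous_id)).integrable_of_hasCompactSupport
      ((hasCompactSupport_moll k).comp_homeomorph (Homeomorph.subLeft x))).const_mul _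
  rw [dist_eq_norm, weilConv_apply, hgx, ← integral_sub hint1 hint2]
  have hb : ∀ u : ℝ, ‖G u * moll k (x - u) - G x * moll k (x - u)‖ ≤ ε / 2 * ‖moll k (x - u)‖ := by
    intro u
    rw [← sub_mul, norm_mul]
    rcases le_or_gt (bump k).rOut |x - u| with hu | hu
    · rw [moll_eq_zero hu]; simp
    · refine mul_le_mul_of_nonneg_right ?_ (norm_nonneg _)
      have hdist : dist u x < δ := by
        rw [dist_comm, Real.dist_eq]; exact hu.trans hk
      exact le_of_lt (by simpa [dist_eq_norm] using hδg hdist)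
  calc ‖∫ u : ℝ, (G u * moll k (x - u) - G x * moll k (x - u))‖
      ≤ ∫ u : ℝ, ‖G u * moll k (x - u) - G x * moll k (x - u)‖ := norm_integral_le_integral_norm _
    _ ≤ ∫ u : ℝ, ε / 2 * ‖moll k (x - u)‖ :=
        integral_mono_of_nonneg (Eventually.of_forall fun _ ↦ norm_nonneg _)
          (((integrable_norm_moll k).comp_sub_left x).const_mul _) (Eventually.of_forall hb)
    _ = ε / 2 := by
        rw [MeasureTheory.integral_const_mul, integral_sub_left_eq_self (fun u ↦ ‖moll k u‖) volume x,
          integral_norm_moll, mul_one]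
    _ < ε := by linarith

/-- **`L²` convergence of mollifications** of a bounded integrable `G` vanishing off `[-R, R]`
and continuous almost everywhere: `∫ |G ⋆ φ_k − G|² → 0` (dominated convergence with the
majorant `(2M)² 𝟙_{[-(R+1), R+1]}`). [folklore] -/
theorem tendsto_integral_norm_sq_weilConv_moll_sub {M R : ℝ} (hGi : Integrable G)
    (hM : ∀ x, ‖G x‖ ≤ M) (hR : ∀ u : ℝ, R < |u| → G u = 0) (hae : ∀ᵐ x, ContinuousAt G x) :
    Tendsto (fun k ↦ ∫ x, ‖weilConv G (moll k) x - G x‖ ^ 2) atTop (𝓝 0) := by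
  have hGs : HasCompactSupport G := by
    refine HasCompactSupport.intro (isCompact_Icc (a := -R) (b := R)) fun x hx ↦ hR x ?_
    by_contra hle
    exact hx (abs_le.1 (not_lt.1 hle))
  have hT : ∀ k, IsWeilTest (weilConv G (moll k)) := fun k ↦
    isWeilTest_weilConv_moll_of_locallyIntegrable hGi.locallyIntegrable hGs k
  have h0 : (0 : ℝ) = ∫ _ : ℝ, (0 : ℝ) := by simp
  rw [h0]
  refine tendsto_integral_of_dominated_convergence
    (fun x ↦ (Icc (-(R + 1)) (R + 1)).indicator (fun _ ↦ (2 * M) ^ 2) x)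
    (fun k ↦ (((hT k).1.continuous.aestronglyMeasurable.sub hGi.aestronglyMeasurable).norm.pow 2))
    (TestDensity.integrable_indicator_Icc_const _ _ _)
    (fun k ↦ Eventually.of_forall fun x ↦ ?_) ?_
  · rw [Real.norm_of_nonneg (by positivity)]
    by_cases hx : x ∈ Icc (-(R + 1)) (R + 1)
    · rw [indicator_of_mem hx]
      have h1 : ‖weilConv G (moll k) x - G x‖ ≤ 2 * M :=
        (norm_sub_le _ _).trans (by linarith [norm_weilConv_moll_le hM k x, hM x])
      exact pow_le_pow_left₀ (norm_nonneg _) h1 2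
    · rw [indicator_of_notMem hx]
      have hx' : R + 1 < |x| := by
        by_contra hle
        exact hx (abs_le.1 (not_lt.1 hle))
      have hx'' : R < |x| := by linarith
      rw [weilConv_moll_eq_zero hR hx' k, hR x hx'', sub_self, norm_zero, zero_pow two_ne_zero]
  · filter_upwards [hae] with x hx
    have h := ((tendsto_weilConv_moll_of_continuousAt hGi hx).sub_const (G x)).norm
    rw [sub_self, norm_zero] at h
    simpa using h.pow 2

/-! ## §4 The cut-off of a continuous function -/

/-- `𝟙_{[-b,b]} f` is integrable for `f` continuous (re-export of the radius file's lemma under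
the engine namespace is not needed; we use it by name) and lies in `L²`. [folklore] -/
theorem memLp_two_cutoffAt (hfc : Continuous f) (b : ℝ) : MemLp (cutoffAt b f) 2 := by
  have hi : Integrable (cutoffAt b f) := integrable_cutoffAt hfc b
  refine (memLp_two_iff_integrable_sq_norm hi.aestronglyMeasurable).2 ?_
  have h2 : (fun x ↦ ‖cutoffAt b f x‖ ^ 2) = (Icc (-b) b).indicator (fun x ↦ ‖f x‖ ^ 2) := by
    funext x
    by_cases hx : x ∈ Icc (-b) b
    · simp [cutoffAt, indicator_of_mem hx]
    · simp [cutoffAt, indicator_of_notMem hx]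
  rw [h2, integrable_indicator_iff measurableSet_Icc]
  exact (by fun_prop : Continuous fun x ↦ ‖f x‖ ^ 2).integrableOn_Icc

/-- `𝟙_{[-b,b]} f` vanishes off every larger window. [folklore] -/
theorem cutoffAt_eq_zero_of_notMem {b a : ℝ} (hba : b ≤ a) (f : ℝ → ℂ) {x : ℝ}
    (hx : x ∉ Icc (-a) a) : cutoffAt b f x = 0 :=
  indicator_of_notMem (fun h ↦ hx ⟨by linarith [h.1], by linarith [h.2]⟩) f

/-- `𝟙_{[-b,b]} f` vanishes outside radius `b`. [folklore] -/
theorem cutoffAt_eq_zero_of_lt (b : ℝ) (f : ℝ → ℂ) {u : ℝ} (hu : b < |u|) : cutoffAt b f u = 0 :=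
  indicator_of_notMem (fun h ↦ by have := abs_le.2 ⟨h.1, h.2⟩; linarith) f

/-- `|𝟙_{[-b,b]} f| ≤ max M 0` when `|f| ≤ M` on the window. [folklore] -/
theorem norm_cutoffAt_le {b M : ℝ} (hM : ∀ x ∈ Icc (-b) b, ‖f x‖ ≤ M) (x : ℝ) :
    ‖cutoffAt b f x‖ ≤ max M 0 := by
  by_cases hx : x ∈ Icc (-b) b
  · simp only [cutoffAt, indicator_of_mem hx]
    exact (hM x hx).trans (le_max_left _ _)
  · simp only [cutoffAt, indicator_of_notMem hx, norm_zero]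
    exact le_max_right _ _

/-- `𝟙_{[-b,b]} f` is continuous at every `x` with `|x| ≠ b` (`f` continuous). [folklore] -/
theorem continuousAt_cutoffAt (hfc : Continuous f) {b x : ℝ} (hx : x ≠ b ∧ x ≠ -b) :
    ContinuousAt (cutoffAt b f) x := by
  by_cases hxin : x ∈ Icc (-b) b
  · -- interior point: the cut-off agrees with `f` near `x`
    have hlt : -b < x ∧ x < b := ⟨lt_of_le_of_ne hxin.1 (Ne.symm hx.2), lt_of_le_of_ne hxin.2 hx.1⟩
    have hev : cutoffAt b f =ᶠ[𝓝 x] f := by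
      filter_upwards [Ioo_mem_nhds hlt.1 hlt.2] with y hy
      exact indicator_of_mem (Ioo_subset_Icc_self hy) f
    exact (hfc.continuousAt.congr hev.symm)
  · -- exterior point: the cut-off vanishes near `x`
    have hev : cutoffAt b f =ᶠ[𝓝 x] fun _ ↦ 0 := by
      filter_upwards [isClosed_Icc.isOpen_compl.mem_nhds hxin] with y hy
      exact indicator_of_notMem hy f
    exact (continuousAt_const.congr hev.symm)

/-- … hence continuous almost everywhere. [folklore] -/
theorem ae_continuousAt_cutoffAt (hfc : Continuous f) (b : ℝ) :
    ∀ᵐ x, ContinuousAt (cutoffAt b f) x := by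
  have hnull : volume ({b, -b} : Set ℝ) = 0 := (Set.toFinite _).measure_zero volume
  filter_upwards [compl_mem_ae_iff.2 hnull] with x hx
  refine continuousAt_cutoffAt hfc ⟨fun h ↦ hx ?_, fun h ↦ hx ?_⟩
  · simp [h]
  · simp [h]

end ClosedFormEngine

end Summit.RiemannHypothesis.RiemannHypothesis.Theorems.PfPersistence
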